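import Literature.AnabelianGeometry.SemiGraphs.PSCSmoothProperGenuineOrigin
import Literature.AnabelianGeometry.SemiGraphs.SurfaceTypeCoveringsToolkit
import Literature.AnabelianGeometry.SemiGraphs.ProSigmaCompletionRestrict
import Literature.AnabelianGeometry.SemiGraphs.ProSigmaCompletionQuotients
import Literature.AnabelianGeometry.SemiGraphs.PSCCoveringDatumTransport
import Literature.GroupTheory.CombinatorialGroupTheory.PuncturedSurfaceGroupFiniteIndexSubgroupHolds
import HarnessLib

/-!
# Finite étale coverings of GENUINE smooth-curve data are genuine smooth-curve data ([CombGC] Def. 1.1 (ii))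

Mochizuki, *A combinatorial version of the Grothendieck conjecture* [CombGC], Tohoku Math. J. **59**
(2007), Def. 1.1 (ii) p. 6: "a finite étale covering of `G` that arises from an open subgroup of `Π_G`"
is again "of pro-`Σ` PSC-type"; a vertex / edge "determines, UP TO CONJUGATION, a closed subgroup";
Rmk. 1.1.5 p. 8 (genus, Riemann–Hurwitz). [cite: MochizukiCombGC2007, Def 1.1(ii) p.6]
[cite: MochizukiCombGC2007, Rmk 1.1.5 p.8]

PROOF-ONLY file (abc-iut cell, layer L3, [CombGC] non-vacuity programme; seat abc-iut-w5-d195 gen 7,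
support brick «SC-GENUINE-COVERING-CLOSED», sequel of `PSCSmoothProperGenuineOrigin.lean`).  The
smooth-CURVE twin of `restrict_smoothProperGenuine`: the GENUINE smooth-curve shape of a datum `G` over a
profinite `Π` —

  one vertex with `Π_v = Π`, no nodes, a pro-`Σ` completion `ι : Γ_{g,r} → Π` of a hyperbolic punctured
  surface group, `genus(v) = g`, a bijection `e : cusps ≃ Fin r`, and the RELAXED cusp clause
  `Π_c = δ_c · closure ι⟨c_{e c}⟩ · δ_c⁻¹` (each cusp group is SOME representative of the conjugacy class
  of the closed cusp inertia group — faithful to Def. 1.1 (ii), and exactly what a covering datum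
  produces; the rigid clause `δ_c = 1` of `PSCSmoothCurveShape.lean` is not stable under coverings)

— is CLOSED under the covering functor `G ↦ G_U = G.restrict U` (`PSCCoveringDatum.lean`) for every
open subgroup `U ⊆ Π` of finite index (`restrict_smoothCurveGenuine`).  The level `ι⁻¹(U) ≤ Γ_{g,r}`
is a `Γ_{g',r'}` WITH ITS PERIPHERAL STRUCTURE by the tree's THEOREM
`puncturedSurfaceGroupFiniteIndexSubgroup_holds` (Hoare–Karrass–Solitar / ZVC 4.14.1, abc-iut F-3146,
proved), `U` is its pro-`Σ` completion (`IsProSigmaCompletion.restrict_comp_of_range_eq`), the cusps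
`⨆_c U \ Π / Π_c` of `G_U` are the cusps of `Γ_{g',r'}` through the double-coset dictionary
`U \ Π / closure ι⟨c_j⟩ ≅ ι⁻¹U \ Γ_{g,r} / ⟨c_j⟩` (density of `ι(Γ)`:
`exists_mem_doubleCoset_map_of_mem_closure`), the cusp groups of `G_U` are `U`-conjugates of the closed
cusp inertia groups of `Γ_{g',r'}` (`restrict_cuspGp_eq_of_rep`), and the Riemann–Hurwitz genus of
`PSCCoveringDatum.restrictGenus` is `g'` (`hurwitzGenus_eq_of_riemannHurwitz`:
`2g' + r' + 2d = d(2g + r) + 2`).  0 definitions; plain (pro)finite group theory over tree theorems;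
nothing here takes a side on [IUTchIII] Cor. 3.12.
-/

noncomputable section

namespace Literature.AnabelianGeometry.SemiGraphs

namespace PSCDatum

open scoped Pointwise
open PSCCovering
open Literature.GroupTheory.CombinatorialGroupTheory
open Literature.GroupTheory.CombinatorialGroupTheory.PuncturedSurfaceGroup (cuspInertia IsHyperbolicType
  peripheralSubgroup)
open SemiGraphOfAnabelioids (IsProSigmaCompletion)
open SemiGraphOfAnabelioids.IsProSigmaCompletion (restrict_comp_of_range_eq finiteIndex_comap
  exists_mem_coset index_comap_of_isOpen)

universe u

variable {P : Type u} [Group P] [TopologicalSpace P]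

/-! ### Arithmetic and combinatorics of the one-vertex shape -/

omit [TopologicalSpace P] in
/-- **Riemann–Hurwitz read as a genus**: if `2g' + r' + 2d = d(2g + r) + 2` then
`hurwitzGenus d g r r' = g'` (`2g' − 2 = d(2g − 2 + r) − r'`). [cite: MochizukiCombGC2007, Rmk 1.1.5 p.8] -/
theorem hurwitzGenus_eq_of_riemannHurwitz {d g r g' r' : ℕ}
    (h : 2 * g' + r' + 2 * d = d * (2 * g + r) + 2) : hurwitzGenus d g r r' = g' := by
  unfold hurwitzGenus
  have hZ : (2 : ℤ) * g' + r' + 2 * d = d * (2 * g + r) + 2 := by exact_mod_cast h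
  have h' : (d : ℤ) * (2 * (g : ℤ) - 2 + (r : ℤ)) - (r' : ℤ) = 2 * ((g' : ℤ) - 1) := by linarith
  rw [h', Int.mul_ediv_cancel_left _ two_ne_zero, add_sub_cancel, Int.toNat_natCast]

omit [TopologicalSpace P] in
/-- With one vertex and no nodes the branch count of the vertex is the number of cusps.
[cite: MochizukiCombGC2007, Def 1.1(i) p.6] -/
theorem branchCount_eq_card_of_forall_eq (𝔾 : PSCSemiGraph) [IsEmpty 𝔾.N] (v₀ : 𝔾.V)
    (hv : ∀ w, w = v₀) (v : 𝔾.V) : 𝔾.branchCount v = Fintype.card 𝔾.C := by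
  simp only [PSCSemiGraph.branchCount, Finset.univ_eq_empty, Finset.sum_empty, add_zero]
  rw [Finset.filter_true_of_mem (fun c _ => (hv _).trans (hv v).symm), Finset.card_univ]

/-! ### Group theory: double cosets along a dense homomorphism -/

omit [TopologicalSpace P] in
/-- `ι(f) · ι(X) · ι(f)⁻¹ = ι(f X f⁻¹)`. [folklore] -/
private theorem toConjAct_smul_map {Γ : Type*} [Group Γ] (ι : Γ →* P) (f : Γ) (X : Subgroup Γ) :
    ConjAct.toConjAct (ι f) • X.map ι = (X.map (MulAut.conj f).toMonoidHom).map ι := by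
  rw [← map_conj_eq_conjAct_smul, Subgroup.map_map, Subgroup.map_map]
  congr 1
  ext x
  simp [MulAut.conj_apply]

variable [IsTopologicalGroup P]

/-- **Density transfer of double cosets.**  For `ι : Γ → Π`, an OPEN subgroup `U ⊆ Π`, a subgroup
`B ≤ Γ` and `x, y ∈ Π`: if `x ∈ U · y · closure(ι B)` then already `x ∈ U · y · ι(B)` — the open set
`y⁻¹ U x` meets `closure(ι B)`, hence meets `ι B`.  (The dictionary between the cusps `U \ Π / Π̄_c` of a
covering of PSC data and the cusps `ι⁻¹U \ Γ / ⟨c⟩` of the corresponding finite-index subgroup of the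
surface group.) [cite: MochizukiCombGC2007, Def 1.1(ii) p.6] -/
theorem exists_mem_doubleCoset_map_of_mem_closure {Γ : Type*} [Group Γ] (ι : Γ →* P)
    (U : Subgroup P) (hU : IsOpen (U : Set P)) (B : Subgroup Γ) {x y a : P}
    (ha : a ∈ (B.map ι).topologicalClosure) (hx : ∃ u ∈ U, x = u * y * a) :
    ∃ u ∈ U, ∃ b ∈ B, x = u * y * ι b := by
  obtain ⟨u, hu, hxe⟩ := hx
  have hS : IsOpen {p : P | x * p⁻¹ * y⁻¹ ∈ U} := hU.preimage (by fun_prop)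
  have haS : a ∈ {p : P | x * p⁻¹ * y⁻¹ ∈ U} := by
    change x * a⁻¹ * y⁻¹ ∈ U
    rw [hxe, show u * y * a * a⁻¹ * y⁻¹ = u by group]
    exact hu
  have ha' : a ∈ closure ((B.map ι : Subgroup P) : Set P) := by
    rw [← Subgroup.topologicalClosure_coe]; exact ha
  obtain ⟨p, hpS, hpB⟩ := mem_closure_iff.mp ha' _ hS haS
  obtain ⟨b, hb, rfl⟩ := hpB
  exact ⟨x * (ι b)⁻¹ * y⁻¹, hpS, b, hb, by group⟩

/-- For a pro-`Σ` completion `ι : Γ → Π`, an open `U ⊆ Π` and `x ∈ Π`: `x = u · ι(f)` with `u ∈ U`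
(the coset `U x` is open and `ι(Γ)` is dense). [cite: MochizukiSemiAnbd2006, Ex. 2.10 p.31] -/
theorem exists_eq_mul_map_of_isProSigmaCompletion {Γ : Type*} [Group Γ] {Sigma : Set ℕ} {ι : Γ →* P}
    (hι : IsProSigmaCompletion Sigma ι) (U : Subgroup P) (hU : IsOpen (U : Set P)) (x : P) :
    ∃ u ∈ U, ∃ f : Γ, x = u * ι f := by
  obtain ⟨f, hf⟩ := exists_mem_coset hι U hU x⁻¹
  rw [inv_inv] at hf
  exact ⟨x * ι f, hf, f⁻¹, by rw [map_inv, mul_inv_cancel_right]⟩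

/-- **The trace on `U` of a conjugate closed cusp inertia group, seen from the level.**  For
`ι : Γ → Π`, `X ≤ Γ`, `U ⊆ Π` open and `f ∈ Γ`:
`ι(f) closure(ι X) ι(f)⁻¹ ∩ U = closure(ι(ι⁻¹U ∩ f X f⁻¹))` (cf. `conjAct_smul_cuspGp_inf_eq` of
`PSCSeparatingCoveringsSmoothCurve.lean`, the same identity at a datum with rigid cusp groups).
[cite: MochizukiCombGC2007, Def 1.1(ii) p.6] -/
theorem conjAct_smul_closure_map_inf_eq {Γ : Type*} [Group Γ] (ι : Γ →* P) (X : Subgroup Γ)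
    (U : Subgroup P) (hU : IsOpen (U : Set P)) (f : Γ) :
    ConjAct.toConjAct (ι f) • (X.map ι).topologicalClosure ⊓ U =
      ((U.comap ι ⊓ X.map (MulAut.conj f).toMonoidHom).map ι).topologicalClosure := by
  rw [← topologicalClosure_conjAct_smul, toConjAct_smul_map, topologicalClosure_map_inf_of_isOpen ι _ U hU,
    inf_comm]

/-- Inside an open (hence closed) subgroup `U ⊆ Π`, closure commutes with the inclusion `U ↪ Π`:
`closure_Π(ι' S) = closure_U(ι' S)` for `ι' : Γ' → U`. [cite: MochizukiCombGC2007, Def 1.1(ii) p.6] -/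
theorem topologicalClosure_map_subtype_comp {Γ' : Type*} [Group Γ'] (U : Subgroup P)
    (hU : IsOpen (U : Set P)) (ι' : Γ' →* U) (S : Subgroup Γ') :
    (S.map (U.subtype.comp ι')).topologicalClosure = ((S.map ι').topologicalClosure).map U.subtype := by
  rw [← Subgroup.map_map]
  exact topologicalClosure_map_of_isClosedEmbedding U.subtype
    (U.isClosed_of_isOpen hU).isClosedEmbedding_subtypeVal _

/-! ### The covering of a genuine smooth curve -/

section SmoothCurve

variable [CompactSpace P] [TotallyDisconnectedSpace P]
variable (G : PSCDatum P) (U : Subgroup P) [U.FiniteIndex] (hU : IsOpen (U : Set P))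
variable {Sigma : Set ℕ} {g r : ℕ}

/-- **The cusps and cusp groups of a finite étale covering of a genuine smooth curve.**  Let `G` have
cusp groups `Π_c = δ_c closure(ι⟨c_{e c}⟩) δ_c⁻¹` for a pro-`Σ` completion `ι : Γ_{g,r} → Π` of a
hyperbolic punctured surface group (`Π` profinite) and a bijection `e : cusps ≃ Fin r`, and let `U ⊆ Π`
be open of finite index.  Then for the punctured surface group `Γ_{g',r'} ≅ ι⁻¹(U)` of the tree's
theorem `puncturedSurfaceGroupFiniteIndexSubgroup_holds` — so `2g' + r' + 2[Π:U] = [Π:U](2g + r) + 2` —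
`ι' := ι| : Γ_{g',r'} → U` is a pro-`Σ` completion, the cusps `⨆_c U \ Π / Π_c` of `G_U` are in a
bijection `e'` with `Fin r'`, and the cusp group of `G_U` at `c'` is a `U`-conjugate of the closed cusp
inertia group `closure ι'⟨c'_{e' c'}⟩`. [cite: MochizukiCombGC2007, Def 1.1(ii) p.6] -/
theorem exists_restrict_cusps_equiv (h : IsHyperbolicType g r) (ι : PuncturedSurfaceGroup g r →* P)
    (hι : IsProSigmaCompletion Sigma ι) (e : G.graph.C ≃ Fin r)
    (hC : ∀ c, ∃ δ : ConjAct P,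
      G.cuspGp c = δ • ((cuspInertia (g := g) (e c)).map ι).topologicalClosure) :
    ∃ (g' r' : ℕ) (ι' : PuncturedSurfaceGroup g' r' →* U) (e' : (G.restrictGraph U).C ≃ Fin r'),
      IsHyperbolicType g' r' ∧ IsProSigmaCompletion Sigma ι' ∧
      2 * g' + r' + 2 * U.index = U.index * (2 * g + r) + 2 ∧
      ∀ c', ∃ γ' : ConjAct U, (G.restrict U hU).cuspGp c' =
        γ' • ((cuspInertia (g := g') (e' c')).map ι').topologicalClosure := by
  classical
  -- (A) the level `K = ι⁻¹(U)` is a `Γ_{g',r'}` with its peripheral structure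
  set K : Subgroup (PuncturedSurfaceGroup g r) := U.comap ι with hK
  haveI : K.FiniteIndex := finiteIndex_comap hι U hU
  obtain ⟨g', r', θ, cusp, rep, h', hθinj, hθr, hRH, hper, huniq⟩ :=
    puncturedSurfaceGroupFiniteIndexSubgroup_holds g r h K inferInstance
  rw [index_comap_of_isOpen hι U hU] at hRH
  have hmem : ∀ x, ι (θ x) ∈ U := fun x => by
    have hx : θ x ∈ K := by rw [← hθr]; exact ⟨x, rfl⟩
    exact hx
  let ι' : PuncturedSurfaceGroup g' r' →* U := (ι.comp θ).codRestrict U hmem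
  have hι' : IsProSigmaCompletion Sigma ι' := restrict_comp_of_range_eq hι U hU θ hθinj hθr hmem
  have hcomp : U.subtype.comp ι' = ι.comp θ := MonoidHom.ext fun _ => rfl
  -- (B) the representatives `δ_c` and the closed cusp inertia groups `A j = closure ι⟨c_j⟩`
  choose δ hδ using hC
  set d : G.graph.C → P := fun c => ConjAct.ofConjAct (δ c) with hd
  have hδ' : ∀ c, G.cuspGp c =
      ConjAct.toConjAct (d c) • ((cuspInertia (g := g) (e c)).map ι).topologicalClosure := fun c => by
    rw [hδ c, hd, ConjAct.toConjAct_ofConjAct]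
  have hmemA : ∀ {c} {z}, z ∈ cuspInertia (g := g) (e c) →
      d c * ι z * (d c)⁻¹ ∈ G.cuspGp c := fun {c} {z} hz => by
    rw [hδ', Subgroup.mem_pointwise_smul_iff_inv_smul_mem, ← ConjAct.toConjAct_inv, ConjAct.smul_def,
      ConjAct.ofConjAct_toConjAct, inv_inv, show (d c)⁻¹ * (d c * ι z * (d c)⁻¹) * d c = ι z by group]
    exact Subgroup.le_topologicalClosure _ (Subgroup.mem_map_of_mem ι hz)
  -- (C) the double-coset dictionary: `U ι(f₁) δ⁻¹ Π_c = U ι(f₂) δ⁻¹ Π_c ↔ K f₁ ⟨c⟩ = K f₂ ⟨c⟩`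
  have hdict : ∀ (c : G.graph.C) (f₁ f₂ : PuncturedSurfaceGroup g r),
      dcIdx U (G.cuspGp c) (ι f₁ * (d c)⁻¹) = dcIdx U (G.cuspGp c) (ι f₂ * (d c)⁻¹) ↔
        ∃ k ∈ K, ∃ z ∈ cuspInertia (g := g) (e c), f₂ = k * f₁ * z := by
    intro c f₁ f₂
    rw [dcIdx_eq_iff]
    constructor
    · rintro ⟨u, hu, p, hp, hup⟩
      rw [hδ', Subgroup.mem_pointwise_smul_iff_inv_smul_mem, ← ConjAct.toConjAct_inv, ConjAct.smul_def,
        ConjAct.ofConjAct_toConjAct, inv_inv] at hp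
      -- `ι f₂ = u ι f₁ a` with `a = δ⁻¹ p δ ∈ A`
      have hx : ∃ u ∈ U, ι f₂ = u * ι f₁ * ((d c)⁻¹ * p * d c) :=
        ⟨u, hu, by rw [show u * ι f₁ * ((d c)⁻¹ * p * d c) = u * (ι f₁ * (d c)⁻¹) * p * d c by group,
          ← hup, inv_mul_cancel_right]⟩
      obtain ⟨u', hu', b, hb, hf₂⟩ := exists_mem_doubleCoset_map_of_mem_closure ι U hU _ hp hx
      refine ⟨f₂ * b⁻¹ * f₁⁻¹, ?_, b, hb, by group⟩
      change ι (f₂ * b⁻¹ * f₁⁻¹) ∈ U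
      rw [map_mul, map_mul, map_inv, map_inv, hf₂, show u' * ι f₁ * ι b * (ι b)⁻¹ * (ι f₁)⁻¹ = u' by group]
      exact hu'
    · rintro ⟨k, hk, z, hz, rfl⟩
      refine ⟨ι k, hk, d c * ι z * (d c)⁻¹, hmemA hz, ?_⟩
      rw [map_mul, map_mul]
      group
  -- density: every `y ∈ Π` is `u ι(f) δ_c⁻¹`
  have hdense : ∀ (c : G.graph.C) (y : P), ∃ u ∈ U, ∃ f, y = u * (ι f * (d c)⁻¹) := fun c y => by
    obtain ⟨u, hu, f, hf⟩ := exists_eq_mul_map_of_isProSigmaCompletion hι U hU (y * d c)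
    exact ⟨u, hu, f, by rw [← mul_assoc, ← hf, mul_inv_cancel_right]⟩
  -- (D) the bijection `Fin r' ≃ cusps of G_U`
  let Φ : Fin r' → (G.restrictGraph U).C := fun j' =>
    ⟨e.symm (cusp j'), dcIdx U (G.cuspGp (e.symm (cusp j'))) (ι (rep j') * (d (e.symm (cusp j')))⁻¹)⟩
  have hΦ_eq : ∀ (j' : Fin r') (c : G.graph.C), e.symm (cusp j') = c →
      Φ j' = ⟨c, dcIdx U (G.cuspGp c) (ι (rep j') * (d c)⁻¹)⟩ := fun j' c hc => by subst hc; rfl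
  have hΦinj : Function.Injective Φ := by
    intro j₁ j₂ h12
    have hc : cusp j₂ = cusp j₁ :=
      e.symm.injective (congrArg (fun s => s.1) h12).symm
    rw [hΦ_eq j₂ (e.symm (cusp j₁)) (by rw [hc]), hΦ_eq j₁ (e.symm (cusp j₁)) rfl] at h12
    have hidx := eq_of_heq (_root_.Sigma.mk.inj_iff.mp h12).2
    obtain ⟨k, hk, z, hz, hrep⟩ := (hdict _ _ _).mp hidx
    rw [Equiv.apply_symm_apply] at hz
    exact (huniq (cusp j₁) (rep j₁)).unique ⟨rfl, 1, K.one_mem, 1, Subgroup.one_mem _, by group⟩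
      ⟨hc, k, hk, z, hz, hrep⟩
  have hΦsurj : Function.Surjective Φ := by
    rintro ⟨c, i⟩
    obtain ⟨u, hu, f, hy⟩ := hdense c (dcRep U (G.cuspGp c) i)
    obtain ⟨j', ⟨hcj, k, hk, z, hz, hrep⟩, -⟩ := huniq (e c) f
    refine ⟨j', ?_⟩
    rw [hΦ_eq j' c (by rw [hcj, Equiv.symm_apply_apply])]
    refine _root_.Sigma.ext rfl (heq_of_eq ?_)
    have hi : i = dcIdx U (G.cuspGp c) (dcRep U (G.cuspGp c) i) := (dcIdx_dcRep U _ i).symm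
    rw [hi, (hdict c (rep j') f).mpr ⟨k⁻¹, K.inv_mem hk, z⁻¹, Subgroup.inv_mem _ hz, by rw [hrep]; group⟩,
      dcIdx_eq_iff]
    exact ⟨u, hu, 1, Subgroup.one_mem _, by rw [hy, mul_one]⟩
  let eΦ : Fin r' ≃ (G.restrictGraph U).C := Equiv.ofBijective Φ ⟨hΦinj, hΦsurj⟩
  -- (E) the cusp groups of `G_U` up to `U`-conjugacy
  have hcusp : ∀ (j' : Fin r') (c : G.graph.C), cusp j' = e c → ∃ γ' : ConjAct U,
      (G.restrict U hU).cuspGp ⟨c, dcIdx U (G.cuspGp c) (ι (rep j') * (d c)⁻¹)⟩ =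
        γ' • ((cuspInertia (g := g') j').map ι').topologicalClosure := by
    intro j' c hcj
    set x : P := ι (rep j') * (d c)⁻¹ with hx
    obtain ⟨u, hu, p, hp, hrep⟩ := exists_dcRep_dcIdx_eq U (G.cuspGp c) x
    set T : Subgroup U := ((cuspInertia (g := g') j').map ι').topologicalClosure with hTdef
    refine ⟨ConjAct.toConjAct ⟨u, hu⟩, ?_⟩
    have hT : ((cuspInertia (g := g') j').map (ι.comp θ)).topologicalClosure = T.map U.subtype := by
      rw [hTdef, ← hcomp]; exact topologicalClosure_map_subtype_comp U hU ι' _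
    -- in `Π`: `ι(rep) closure(ι⟨c_{e c}⟩) ι(rep)⁻¹ ∩ U = closure(ι θ ⟨c'_{j'}⟩)` (peripheral structure)
    have hP0 : ConjAct.toConjAct (ι (rep j')) •
        ((cuspInertia (g := g) (e c)).map ι).topologicalClosure ⊓ U = T.map U.subtype := by
      rw [conjAct_smul_closure_map_inf_eq ι _ U hU, ← hT, ← hcj]
      change ((peripheralSubgroup K (cusp j') (rep j')).map ι).topologicalClosure = _
      rw [← hper j', Subgroup.map_map]
    -- in `Π`: `y Π_c y⁻¹ ∩ U = u (closure ι θ ⟨c'_{j'}⟩) u⁻¹` for the representative `y = u x p`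
    have hP : ConjAct.toConjAct (dcRep U (G.cuspGp c) (dcIdx U (G.cuspGp c) x)) • G.cuspGp c ⊓ U =
        ConjAct.toConjAct u • T.map U.subtype := by
      rw [hrep, hx, map_mul, map_mul, map_mul, map_inv, mul_smul, mul_smul, mul_smul,
        conjAct_smul_eq_self_of_mem hp, hδ' c, inv_smul_smul, ← hP0, Subgroup.smul_inf,
        conjAct_smul_eq_self_of_mem hu]
    rw [restrict_cuspGp]
    change (ConjAct.toConjAct (dcRep U (G.cuspGp c) (dcIdx U (G.cuspGp c) x)) • G.cuspGp c).subgroupOf U = _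
    rw [← Subgroup.inf_subgroupOf_right, hP]
    conv_rhs => rw [show T = (T.map U.subtype).subgroupOf U from
      (Subgroup.comap_map_eq_self_of_injective U.subtype_injective _).symm]
    rw [conj_subgroupOf_eq, Subgroup.coe_mk]
  refine ⟨g', r', ι', eΦ.symm, h', hι', hRH, fun c' => ?_⟩
  obtain ⟨j', rfl⟩ := eΦ.surjective c'
  rw [Equiv.symm_apply_apply]
  change ∃ γ' : ConjAct U, (G.restrict U hU).cuspGp (Φ j') = _
  rw [hΦ_eq j' (e.symm (cusp j')) rfl]
  exact hcusp j' _ (by rw [Equiv.apply_symm_apply])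

/-- **Covering-closedness of the genuine smooth-curve shape (relaxed cusp clause).**  If `G` is a datum
over a profinite `Π` with no nodes, one vertex with `Π_v = Π`, a pro-`Σ` completion `ι : Γ_{g,r} → Π`
of a hyperbolic punctured surface group with `genus(v) = g`, a bijection `e : cusps ≃ Fin r` and cusp
groups `Π_c = δ_c closure(ι⟨c_{e c}⟩) δ_c⁻¹`, then for every open subgroup `U ⊆ Π` of finite index the
covering datum `G_U = G.restrict U` (Def. 1.1 (ii)) is of the same kind: no nodes, one vertex with
`Π_w = U`, a pro-`Σ` completion `ι' : Γ_{g',r'} → U` of a hyperbolic punctured surface group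
(`2g' + r' + 2[Π:U] = [Π:U](2g + r) + 2`), `genus(w) = g'` (Riemann–Hurwitz), a bijection
`e' : cusps(G_U) ≃ Fin r'`, and cusp groups `U`-conjugate to `closure(ι'⟨c'_{e' c'}⟩)`.
[cite: MochizukiCombGC2007, Def 1.1(ii) p.6] -/
theorem restrict_smoothCurveGenuine [IsEmpty G.graph.N] (hV : ∀ v, G.vertGp v = ⊤) (v₀ : G.graph.V)
    (hv : ∀ w, w = v₀) (h : IsHyperbolicType g r) (ι : PuncturedSurfaceGroup g r →* P)
    (hι : IsProSigmaCompletion G.Sigma ι) (e : G.graph.C ≃ Fin r)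
    (hC : ∀ c, ∃ δ : ConjAct P,
      G.cuspGp c = δ • ((cuspInertia (g := g) (e c)).map ι).topologicalClosure)
    (hgen : ∀ v, G.genus v = g) :
    IsEmpty (G.restrict U hU).graph.N ∧ (∀ w, (G.restrict U hU).vertGp w = ⊤) ∧
      (∃ w₀ : (G.restrict U hU).graph.V, ∀ w, w = w₀) ∧
      ∃ (g' r' : ℕ) (ι' : PuncturedSurfaceGroup g' r' →* U) (e' : (G.restrict U hU).graph.C ≃ Fin r'),
        IsHyperbolicType g' r' ∧ IsProSigmaCompletion (G.restrict U hU).Sigma ι' ∧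
        2 * g' + r' + 2 * U.index = U.index * (2 * g + r) + 2 ∧
        (∀ w, (G.restrict U hU).genus w = g') ∧
        ∀ c', ∃ γ' : ConjAct U, (G.restrict U hU).cuspGp c' =
          γ' • ((cuspInertia (g := g') (e' c')).map ι').topologicalClosure := by
  obtain ⟨g', r', ι', e', h', hι', hRH, hcusp⟩ := G.exists_restrict_cusps_equiv U hU h ι hι e hC
  haveI hN' : IsEmpty (G.restrictGraph U).N := G.isEmpty_restrictGraph_N U
  obtain ⟨w₀, hw⟩ := G.exists_forall_eq_restrictGraph_V U hV v₀ hv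
  refine ⟨hN', G.restrict_vertGp_eq_top U hU hV, ⟨w₀, hw⟩, g', r', ι', e', h', hι', hRH, fun w => ?_,
    hcusp⟩
  -- Riemann–Hurwitz: `genus(w) = hurwitzGenus [Π:U] g r r' = g'`
  change G.restrictGenus U w = g'
  rw [restrictGenus, G.localDegree_eq_index U hV, hgen,
    branchCount_eq_card_of_forall_eq G.graph v₀ hv, branchCount_eq_card_of_forall_eq _ w₀ hw,
    Fintype.card_congr e, Fintype.card_fin, Fintype.card_congr e', Fintype.card_fin]
  exact hurwitzGenus_eq_of_riemannHurwitz hRH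

end SmoothCurve

end PSCDatum

end Literature.AnabelianGeometry.SemiGraphs

end
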